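import Summits.AtomisticToContinuum.HydrodynamicLimit.Theorems.CorrectorPressureDecay.Negative.OrthMomentumTools

/-!
# `CorrectorPressureDecay` — negative knowledge (a.1′): orthogonality to the MOMENTUM is load-bearing at EVERY amplitude

Support file for crux `stmt-AtomisticToContinuum-14135` (`AntiMazurCoboundaries.CorrectorPressureDecay`, "X"),
written by the standing disprover (cdisprove seat, cycle 2). Refines (a.1) (`Negative/WithoutOrthogonality.lean`:
dropping the whole clause `g ⊥ span(1, v, |v|²)` is fatal via `g ≡ κ`): here ONLY the momentum part is dropped —
the clause is weakened to `g ⊥ span(1, |v|²)` — and X is still FALSE, for EVERY amplitude `κ` the prover may choose.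
Mechanism (the exponential Mazur charge bound with an UNBOUNDED invariant tilt): tilt the invariant Gibbs law by the
conserved momentum component `βP₀ = βΣᵢ(vᵢ)₀` (`Pobs_flow`, sibling crux BoltzmannGreenKubo's landed library); the
tilted law is again flow-invariant, so every coboundary corrector has tilted mean zero, and Jensen under the tilt
(`tilted_jensen'`, integrability form) gives
`log ∫e^{2F − 2D_W} dG_N ≥ log E e^{βP₀} + E_β[2F] − βE_β[P₀] = (N+1)[β²/2 + 2κ e^{−1/2} sin β − β²]`
for the odd witness `g(v) = κ sin v₀` (⊥ 1, ⊥ |v|², NOT ⊥ v₀; the tilted one-body law is `N(βe₀, I)`, and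
`E sin(β + Z) = e^{−1/2} sin β` by the Gaussian characteristic function) — a FIRST-order gain `≈ 1.2κβ` against a
SECOND-order entropy price `β²/2`: positive for small `β` whatever `κ` (`β = min(κ,1)/4`, `δ = min(κ,1)²/20`).
So the first-order (linear-response) shell floors are amplitude-independent; only orthogonality to `v` (and to
`|v|²`, the energy twin) removes them, while the `∃κ` clause removes the second-order ones (`Negative/AllAmplitudes`).

* Tools (`tilted_jensen'`, `measurePreserving_tilted_ae`, the Gaussian integrals) are in `Negative/OrthMomentumTools.lean`;
* `CorrectorPressureDecayWithoutOrthMomentum` (variant statement, refuted; not a fact) and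
  `correctorPressureDecay_false_without_orthMomentum`.
-/

noncomputable section

open MeasureTheory ProbabilityTheory Set Filter Topology
open scoped ENNReal

namespace Summit.AtomisticToContinuum.HydrodynamicLimit.Theorems.CorrectorPressureDecayNegative.OrthMomentum

open Literature.MathematicalPhysics.KineticTheory (T3 V3 hsDiameter localGibbsLaw localGibbsMeasure
  localGibbsProfile localGibbsLaw_eq isProbabilityMeasure_localGibbsLaw localGibbsMeasure_absolutelyContinuous)
open Literature.Analysis.FluidPDE (HardSphereFlow Config)
open Summit.AtomisticToContinuum.HydrodynamicLimit.Theorems.BoltzmannGreenKuboOrthMomentum (velOf measurable_velOf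
  integral_velOf_localGibbsLaw integrable_velOf_localGibbsLaw Pobs Pobs_flow measurable_Pobs measurePreserving_coord
  integral_exp_mul_gaussianReal)

/-! ## §4 The refutation -/

/-- Hard-sphere flows of `N + 1` spheres of reduced diameter `σ` on `𝕋³` (the crux's `Φ`). -/
abbrev Flow (σ : ℝ) (N : ℕ) : Type :=
  HardSphereFlow (Literature.Analysis.FluidPDE.Torus.geometry (Fin 3)) (hsDiameter σ N) (N + 1)

/-- Phase space of `N + 1` spheres on `𝕋³`. -/
abbrev Phase (N : ℕ) : Type := Config (N + 1) (Fin 3) T3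

/-- `CorrectorPressureDecay` with the orthogonality clause WEAKENED to `g ⊥ span(1, |v|²)` (the momentum term
`inner b v` deleted; all other tokens verbatim). A variant statement refuted below, not a fact. -/
def CorrectorPressureDecayWithoutOrthMomentum : Prop :=
  ∀ (a θ : ℝ) (u₀ : V3), 0 < a → 0 < θ → ∃ σ₀ : ℝ, 0 < σ₀ ∧ ∀ σ : ℝ, 0 < σ → σ < σ₀ →
    (∀ (N : ℕ) (Φ : Flow σ N),
      IsProbabilityMeasure (localGibbsLaw σ (fun _ => a) (fun _ => u₀) (fun _ => θ) N Φ)) ∧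
    ∃ κ : ℝ, 0 < κ ∧ ∀ (φ : T3 → ℝ) (g : V3 → ℝ), Continuous φ → Continuous g → (∀ x, |φ x| ≤ 1) →
      (∀ v, |g v| ≤ κ) →
      (∀ (c₀ c₂ : ℝ), ∫ v, g v * (c₀ + c₂ * ‖v‖ ^ 2) ∂stdGaussian V3 = 0) →
      ∀ δ : ℝ, 0 < δ → ∃ τ₀ : ℝ, 0 < τ₀ ∧ ∃ N₀ : ℕ, ∀ N : ℕ, N₀ ≤ N → ∀ Φ : Flow σ N,
        ∃ lag : ℝ, 0 < lag ∧ ∃ W : Phase N → ℝ, Measurable W ∧ (∃ C : ℝ, ∀ z, |W z| ≤ C) ∧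
          ∫⁻ z, ENNReal.ofReal (Real.exp (2 * ((∑ i, φ (z i).1 * g ((Real.sqrt θ)⁻¹ • ((z i).2 - u₀))) -
              lag⁻¹ * (W (Φ.flow lag z) - W z))))
            ∂(localGibbsLaw σ (fun _ => a) (fun _ => u₀) (fun _ => θ) N Φ) ≤
            ENNReal.ofReal (Real.exp (δ * (N + 1))) ∧
          ∫⁻ z, ENNReal.ofReal (Real.exp (4 * (τ₀ * ((N + 1 : ℕ) : ℝ) ^ (-(1 / 3 : ℝ)))⁻¹ * |W z|))
            ∂(localGibbsLaw σ (fun _ => a) (fun _ => u₀) (fun _ => θ) N Φ) ≤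
            ENNReal.ofReal (Real.exp (δ * (N + 1)))

/-- The witness `g(v) = κ sin v₀` is `γ`-orthogonal to `span(1, |v|²)` (odd under `v ↦ −v`). [folklore] -/
theorem sin_coord_orth (κ c₀ c₂ : ℝ) :
    ∫ v, κ * Real.sin (v 0) * (c₀ + c₂ * ‖v‖ ^ 2) ∂stdGaussian V3 = 0 := by
  refine integral_stdGaussian_eq_zero_of_odd (LinearIsometryEquiv.neg ℝ) fun v => ?_
  have h0 : (LinearIsometryEquiv.neg ℝ v) 0 = -(v 0) := rfl
  rw [h0, Real.sin_neg, LinearIsometryEquiv.coe_neg, norm_neg]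
  ring

/-- `|x| ≤ eˣ + e⁻ˣ`. [folklore] -/
theorem abs_le_exp_add_exp_neg (x : ℝ) : |x| ≤ Real.exp x + Real.exp (-x) := by
  have h1 := Real.add_one_le_exp x
  have h2 := Real.add_one_le_exp (-x)
  have h3 := Real.exp_pos x
  have h4 := Real.exp_pos (-x)
  rw [abs_le]
  constructor <;> linarith

/-- **Orthogonality to the MOMENTUM is load-bearing at every amplitude: X so weakened is FALSE.** Witness
`a = θ = 1`, `u₀ = 0`, `σ = min(σ₀/2, 1/4)`, `φ ≡ 1`, `g = κ sin v₀` (the prover's own `κ`), `m = min(κ, 1)`,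
`β = m/4`, `δ = m²/20`, `N = N₀`, any flow: the momentum tilt `βΣᵢ(vᵢ)₀` of `G_N` is flow-invariant
(`Pobs_flow` a.e.), so by `tilted_jensen'` the defect pressure per particle is at least
`β²/2 + 2κ e^{−1/2} sin β − β² ≥ (83/384) m² > δ`. [folklore] -/
theorem correctorPressureDecay_false_without_orthMomentum : ¬ CorrectorPressureDecayWithoutOrthMomentum := by
  intro h
  obtain ⟨σ₀, hσ₀, hσ⟩ := h 1 1 0 one_pos one_pos
  set σ : ℝ := min (σ₀ / 2) 4⁻¹ with hσdef
  have hσpos : 0 < σ := lt_min (by linarith) (by norm_num)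
  have hσlt : σ < σ₀ := (min_le_left _ _).trans_lt (by linarith)
  have hσ2 : σ ≤ 1 / 2 := (min_le_right _ _).trans (by norm_num)
  have hσ2' : σ < 2⁻¹ := (min_le_right _ _).trans_lt (by norm_num)
  obtain ⟨hprob, κ, hκ, hmain⟩ := hσ σ hσpos hσlt
  -- parameters
  set m : ℝ := min κ 1 with hm
  have hm0 : 0 < m := lt_min hκ one_pos
  have hmκ : m ≤ κ := min_le_left _ _
  have hm1 : m ≤ 1 := min_le_right _ _
  set β : ℝ := m / 4 with hβ
  have hβpos : 0 < β := by positivity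
  have hβle : β ≤ 1 / 4 := by rw [hβ]; linarith
  set δ : ℝ := m ^ 2 / 20 with hδ
  have hδpos : 0 < δ := by positivity
  -- the witness
  set g : V3 → ℝ := fun v => κ * Real.sin (v 0) with hg
  have hgc : Continuous g := by
    have h0 : Continuous fun w : V3 => w 0 := (EuclideanSpace.proj (𝕜 := ℝ) (0 : Fin 3)).continuous
    exact continuous_const.mul (Real.continuous_sin.comp h0)
  have hgκ : ∀ v, |g v| ≤ κ := fun v => by
    rw [hg, abs_mul, abs_of_pos hκ]
    exact mul_le_of_le_one_right hκ.le (Real.abs_sin_le_one _)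
  obtain ⟨τ₀, _hτ₀, N₀, hN⟩ := hmain (fun _ => 1) g continuous_const hgc (fun _ => by simp) hgκ
    (fun c₀ c₂ => sin_coord_orth κ c₀ c₂) δ hδpos
  obtain ⟨Φ⟩ := nonempty_flow hσpos hσ2' N₀
  obtain ⟨lag, hlag, W, hWm, ⟨CW, hW⟩, h1, _h2⟩ := hN N₀ le_rfl Φ
  haveI := hprob N₀ Φ
  set G := localGibbsLaw σ (fun _ => (1 : ℝ)) (fun _ => (0 : V3)) (fun _ => (1 : ℝ)) N₀ Φ with hGdef
  have hT : MeasurePreserving (Φ.flow lag) G G := measurePreserving_flow_localGibbsLaw 1 1 N₀ Φ lag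
  have hgood : G Φ.goodᶜ = 0 := by
    rw [hGdef, localGibbsLaw_eq]
    exact localGibbsMeasure_absolutelyContinuous σ _ _ _ N₀ Φ Φ.measure_compl_good
  -- the invariant tilt `V = β P₀`
  set V : Phase N₀ → ℝ := fun z => β * Pobs z with hV
  have hVm : Measurable V := measurable_const.mul measurable_Pobs
  have hVinv : ∀ᵐ z ∂G, V (Φ.flow lag z) = V z := by
    have : ∀ᵐ z ∂G, z ∈ Φ.good := mem_ae_iff.2 hgood
    filter_upwards [this] with z hz
    simp only [hV, Pobs_flow Φ hz lag]
  -- velocity-only reduction data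
  have hVvel : ∀ z : Phase N₀, V z = (fun v : Fin (N₀ + 1) → V3 => β * ∑ i, v i 0) (velOf z) := fun z => rfl
  have hexpV : ∀ c : ℝ, Integrable (fun z : Phase N₀ => Real.exp (c * Pobs z)) G := by
    intro c
    have := integrable_velOf_localGibbsLaw hσ2 N₀ Φ (integrable_exp_mul_sum_coord N₀ c)
    exact this
  have hVexp : Integrable (fun z => Real.exp (V z)) G := hexpV β
  -- the tilted law `Q` is flow-invariant
  set Q : Measure (Phase N₀) := G.tilted V with hQ
  haveI hQprob : IsProbabilityMeasure Q := isProbabilityMeasure_tilted hVexp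
  have hTQ : MeasurePreserving (Φ.flow lag) Q Q := measurePreserving_tilted_ae hT hVm hVinv
  -- the defect integrand `Y = F − 2 lag⁻¹ (W∘Φ − W)`, `F = Σ 2κ sin (vᵢ)₀`
  set F : Phase N₀ → ℝ := fun z => ∑ i, 2 * κ * Real.sin ((z i).2 0) with hF
  have hFm : Measurable F := by
    refine Finset.measurable_sum _ fun i _ => ?_
    exact measurable_const.mul (Real.continuous_sin.measurable.comp
      ((EuclideanSpace.proj (𝕜 := ℝ) (0 : Fin 3)).continuous.measurable.comp (measurable_pi_apply i).snd))
  have hFb : ∀ z, |F z| ≤ ∑ _i : Fin (N₀ + 1), 2 * κ := fun z =>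
    (Finset.abs_sum_le_sum_abs _ _).trans (Finset.sum_le_sum fun i _ => by
      rw [abs_mul, abs_of_pos (by positivity : (0 : ℝ) < 2 * κ)]
      exact mul_le_of_le_one_right (by positivity) (Real.abs_sin_le_one _))
  set Y : Phase N₀ → ℝ := fun z => F z - 2 * lag⁻¹ * (W (Φ.flow lag z) - W z) with hY
  have hrw1 : ∀ z : Phase N₀, Real.exp (2 * ((∑ i, (fun _ : T3 => (1 : ℝ)) (z i).1 *
      g ((Real.sqrt 1)⁻¹ • ((z i).2 - 0))) - lag⁻¹ * (W (Φ.flow lag z) - W z))) = Real.exp (Y z) := by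
    intro z
    simp only [hY, hF, hg, Real.sqrt_one, inv_one, sub_zero, one_smul, one_mul]
    congr 1
    rw [mul_sub, Finset.mul_sum]
    congr 1
    · exact Finset.sum_congr rfl fun i _ => by ring
    · ring
  simp_rw [hrw1] at h1
  have hWΦm : Measurable fun z => W (Φ.flow lag z) := hWm.comp (Φ.measurable_flow lag)
  have hYm : Measurable Y := hFm.sub (measurable_const.mul (hWΦm.sub hWm))
  have hYb : ∀ z, |Y z| ≤ (∑ _i : Fin (N₀ + 1), 2 * κ) + |2 * lag⁻¹| * (CW + CW) := by
    intro z
    calc |Y z| ≤ |F z| + |2 * lag⁻¹ * (W (Φ.flow lag z) - W z)| := abs_sub _ _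
      _ = |F z| + |2 * lag⁻¹| * |W (Φ.flow lag z) - W z| := by
          rw [abs_mul (2 * lag⁻¹) (W (Φ.flow lag z) - W z)]
      _ ≤ _ := by
          gcongr
          · exact hFb z
          · exact (abs_sub _ _).trans (add_le_add (hW _) (hW _))
  have hYexp : Integrable (fun z => Real.exp (Y z)) G := integrable_exp_of_abs_le hYm hYb
  have hI1 : ∫ z, Real.exp (Y z) ∂G ≤ Real.exp (δ * (N₀ + 1)) := by
    rw [← ofReal_integral_eq_lintegral_ofReal hYexp (ae_of_all _ fun _ => (Real.exp_pos _).le),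
      ENNReal.ofReal_le_ofReal_iff (Real.exp_pos _).le] at h1
    exact h1
  -- integrability of `V` under `Q`
  have hVQ : Integrable V Q := by
    rw [hQ, integrable_tilted_iff hVexp]
    have hbound : Integrable (fun z => β * (Real.exp ((β + 1) * Pobs z) + Real.exp ((β - 1) * Pobs z))) G :=
      ((hexpV (β + 1)).add (hexpV (β - 1))).const_mul β
    refine hbound.mono' ((Real.continuous_exp.measurable.comp hVm).smul hVm).aestronglyMeasurable
      (ae_of_all _ fun z => ?_)
    simp only [hV, smul_eq_mul, Real.norm_eq_abs]
    rw [abs_mul, abs_of_pos (Real.exp_pos _), abs_mul, abs_of_pos hβpos]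
    have hx := abs_le_exp_add_exp_neg (Pobs z)
    have hpos := Real.exp_pos (β * Pobs z)
    calc Real.exp (β * Pobs z) * (β * |Pobs z|) = β * (Real.exp (β * Pobs z) * |Pobs z|) := by ring
      _ ≤ β * (Real.exp (β * Pobs z) * (Real.exp (Pobs z) + Real.exp (-Pobs z))) := by gcongr
      _ = β * (Real.exp ((β + 1) * Pobs z) + Real.exp ((β - 1) * Pobs z)) := by
          rw [mul_add, ← Real.exp_add, ← Real.exp_add]
          congr 2 <;> congr 1 <;> ring
  have hYQ : Integrable Y Q := integrable_of_abs_le hYm hYb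
  have hYV : Integrable (fun z => Y z - V z) Q := hYQ.sub hVQ
  -- TILTED JENSEN
  have hJ := tilted_jensen' (μ := G) hVexp hYexp hYV
  -- evaluate `∫ (Y − V) dQ = E_Q F − E_Q V` (the coboundary drops by invariance of `Q`)
  have hFQ : Integrable F Q := integrable_of_abs_le hFm hFb
  have hWQ : Integrable W Q := integrable_of_abs_le hWm hW
  have hWΦQ : Integrable (fun z => W (Φ.flow lag z)) Q := integrable_of_abs_le hWΦm fun z => hW _
  have hWT : ∫ z, W (Φ.flow lag z) ∂Q = ∫ z, W z ∂Q := by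
    rw [← integral_map hTQ.measurable.aemeasurable hWm.aestronglyMeasurable, hTQ.map_eq]
  have hmean : ∫ z, (Y z - V z) ∂Q = (∫ z, F z ∂Q) - ∫ z, V z ∂Q := by
    have hD : Integrable (fun z => 2 * lag⁻¹ * (W (Φ.flow lag z) - W z)) Q := (hWΦQ.sub hWQ).const_mul _
    have hFD : Integrable (fun z => F z - 2 * lag⁻¹ * (W (Φ.flow lag z) - W z)) Q := hFQ.sub hD
    have e1 : (fun z => Y z - V z) = fun z => (F z - 2 * lag⁻¹ * (W (Φ.flow lag z) - W z)) - V z := rfl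
    rw [e1, integral_sub hFD hVQ, integral_sub hFQ hD, integral_const_mul, integral_sub hWΦQ hWQ, hWT,
      sub_self, mul_zero, sub_zero]
  -- the three Gaussian values
  set E1 : ℝ := Real.exp (β ^ 2 / 2) with hE1
  have hZ : ∫ z, Real.exp (V z) ∂G = E1 ^ (N₀ + 1) := by
    have := integral_velOf_localGibbsLaw hσ2 N₀ Φ (H := fun v : Fin (N₀ + 1) → V3 => Real.exp (β * ∑ i, v i 0))
      (by fun_prop)
    rw [integral_exp_mul_sum_coord] at this
    exact this
  have hnumF : ∫ z, F z * Real.exp (V z) ∂G =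
      ((N₀ : ℝ) + 1) * (2 * κ * (E1 * (Real.exp (-(1 / 2)) * Real.sin β))) * E1 ^ N₀ := by
    have hH : Measurable fun v : Fin (N₀ + 1) → V3 =>
        ∑ i, 2 * κ * Real.sin (v i 0) * Real.exp (β * ∑ j, v j 0) := by
      fun_prop
    have := integral_velOf_localGibbsLaw hσ2 N₀ Φ hH
    have hlhs : (fun z : Phase N₀ => F z * Real.exp (V z)) =
        fun z => (fun v : Fin (N₀ + 1) → V3 => ∑ i, 2 * κ * Real.sin (v i 0) * Real.exp (β * ∑ j, v j 0))
          (velOf z) := by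
      funext z
      show F z * Real.exp (V z) = ∑ i, 2 * κ * Real.sin ((velOf z) i 0) * Real.exp (β * ∑ j, (velOf z) j 0)
      rw [hF, hV, Finset.sum_mul]
      rfl
    rw [hlhs, this]
    have hterm : ∀ i : Fin (N₀ + 1), Integrable (fun v : Fin (N₀ + 1) → V3 =>
        2 * κ * Real.sin (v i 0) * Real.exp (β * ∑ j, v j 0)) (piGauss N₀) := by
      intro i
      refine ((integrable_exp_mul_sum_coord N₀ β).const_mul (2 * κ)).mono' (by fun_prop)
        (ae_of_all _ fun v => ?_)
      rw [Real.norm_eq_abs, abs_mul, abs_mul, abs_of_pos (by positivity : (0 : ℝ) < 2 * κ),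
        abs_of_pos (Real.exp_pos _)]
      exact mul_le_mul_of_nonneg_right (mul_le_of_le_one_right (by positivity) (Real.abs_sin_le_one _))
        (Real.exp_pos _).le
    rw [integral_finsetSum _ fun i _ => hterm i]
    have hi : ∀ i : Fin (N₀ + 1), ∫ v, 2 * κ * Real.sin (v i 0) * Real.exp (β * ∑ j, v j 0) ∂piGauss N₀ =
        2 * κ * (E1 * (Real.exp (-(1 / 2)) * Real.sin β)) * E1 ^ N₀ := by
      intro i
      have := integral_mul_exp_mul_sum_coord N₀ β (h := fun x => 2 * κ * Real.sin x) (by fun_prop) i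
      simp only at this
      rw [this]
      have h1d : ∫ x, 2 * κ * Real.sin x * Real.exp (β * x) ∂gaussianReal 0 1 =
          2 * κ * (E1 * (Real.exp (-(1 / 2)) * Real.sin β)) := by
        simp_rw [mul_assoc]
        rw [integral_const_mul, integral_const_mul, integral_sin_mul_exp_gaussianReal β, ← hE1]
      rw [h1d]
    simp only [hi, Finset.sum_const, Finset.card_univ, Fintype.card_fin, nsmul_eq_mul]
    push_cast
    ring
  -- `A = E_Q F = (N+1)·2κ e^{-1/2} sin β`
  have hE1pos : 0 < E1 := by rw [hE1]; exact Real.exp_pos _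
  have hA : ∫ z, F z ∂Q = ((N₀ : ℝ) + 1) * (2 * κ * (Real.exp (-(1 / 2)) * Real.sin β)) := by
    rw [hQ, integral_tilted]
    have : (fun z => (Real.exp (V z) / ∫ x, Real.exp (V x) ∂G) • F z) =
        fun z => (∫ x, Real.exp (V x) ∂G)⁻¹ * (F z * Real.exp (V z)) := by
      funext z; simp only [smul_eq_mul]; ring
    rw [this, integral_const_mul, hnumF, hZ, pow_succ]
    field_simp
  -- the Gibbs bound on `B = E_Q V`: `Z · e^{B} ≤ ∫ e^{2V} dG = E2^{N+1}`
  have hV2exp : Integrable (fun z => Real.exp (2 * V z)) G := by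
    have := hexpV (2 * β)
    refine this.congr (ae_of_all _ fun z => ?_)
    simp only [hV]
    ring_nf
  have hJ2 := tilted_jensen' (μ := G) (V := V) (Y := fun z => 2 * V z) hVexp hV2exp
    (by simpa [two_mul] using hVQ)
  have hB2 : ∫ z, (2 * V z - V z) ∂Q = ∫ z, V z ∂Q := by
    congr 1; funext z; ring
  rw [hB2] at hJ2
  set E2 : ℝ := Real.exp ((2 * β) ^ 2 / 2) with hE2
  have hZ2 : ∫ z, Real.exp (2 * V z) ∂G = E2 ^ (N₀ + 1) := by
    have := integral_velOf_localGibbsLaw hσ2 N₀ Φ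
      (H := fun v : Fin (N₀ + 1) → V3 => Real.exp ((2 * β) * ∑ i, v i 0)) (by fun_prop)
    rw [integral_exp_mul_sum_coord] at this
    rw [← this]
    congr 1
    funext z
    show Real.exp (2 * V z) = Real.exp ((2 * β) * ∑ i, (velOf z) i 0)
    rw [hV]
    congr 1
    show 2 * (β * Pobs z) = 2 * β * ∑ i, (velOf z) i 0
    rw [mul_assoc]
    rfl
  rw [hZ2, hZ] at hJ2
  -- combine: `Z² e^{A} ≤ e^{δ(N+1)} · E2^{N+1}`
  rw [hmean, hA, hZ] at hJ
  set A : ℝ := ((N₀ : ℝ) + 1) * (2 * κ * (Real.exp (-(1 / 2)) * Real.sin β)) with hAdef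
  set B : ℝ := ∫ z, V z ∂Q with hBdef
  have hJ' : E1 ^ (N₀ + 1) * Real.exp (A - B) ≤ Real.exp (δ * (N₀ + 1)) := hJ.trans hI1
  have hprod : (E1 ^ (N₀ + 1) * Real.exp (A - B)) * (E1 ^ (N₀ + 1) * Real.exp B) ≤
      Real.exp (δ * (N₀ + 1)) * E2 ^ (N₀ + 1) :=
    mul_le_mul hJ' hJ2 (by positivity) (by positivity)
  have hE1pow : E1 ^ (N₀ + 1) = Real.exp (((N₀ : ℝ) + 1) * (β ^ 2 / 2)) := by
    rw [hE1, ← Real.exp_nat_mul]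
    congr 1
    push_cast
    ring
  have hE2pow : E2 ^ (N₀ + 1) = Real.exp (((N₀ : ℝ) + 1) * (2 * β ^ 2)) := by
    rw [hE2, ← Real.exp_nat_mul]
    congr 1
    push_cast
    ring
  have hlhs : (E1 ^ (N₀ + 1) * Real.exp (A - B)) * (E1 ^ (N₀ + 1) * Real.exp B) =
      Real.exp (((N₀ : ℝ) + 1) * β ^ 2 + A) := by
    rw [hE1pow, ← Real.exp_add, ← Real.exp_add, ← Real.exp_add]
    congr 1
    ring
  have hrhs : Real.exp (δ * (N₀ + 1)) * E2 ^ (N₀ + 1) = Real.exp (((N₀ : ℝ) + 1) * (δ + 2 * β ^ 2)) := by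
    rw [hE2pow, ← Real.exp_add]
    congr 1
    ring
  rw [hlhs, hrhs, Real.exp_le_exp] at hprod
  -- per particle: `2κ e^{-1/2} sin β ≤ δ + β²`, contradicting the numbers
  have hn : (0 : ℝ) < (N₀ : ℝ) + 1 := by positivity
  have hpp : 2 * κ * (Real.exp (-(1 / 2)) * Real.sin β) ≤ δ + β ^ 2 := by
    have : ((N₀ : ℝ) + 1) * (2 * κ * (Real.exp (-(1 / 2)) * Real.sin β)) ≤ ((N₀ : ℝ) + 1) * (δ + β ^ 2) := by
      rw [hAdef] at hprod; linarith
    exact le_of_mul_le_mul_left this hn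
  have he : 1 / 2 ≤ Real.exp (-(1 / 2)) := by linarith [Real.add_one_le_exp (-(1 / 2) : ℝ)]
  have hsin : β - β ^ 3 / 6 < Real.sin β := Real.sin_gt_sub_cube hβpos
  have hsinpos : 0 ≤ Real.sin β := Real.sin_nonneg_of_nonneg_of_le_pi hβpos.le (by linarith [Real.pi_gt_three])
  have hβsq : β ^ 2 ≤ 1 / 16 := by
    have := pow_le_pow_left₀ hβpos.le hβle 2
    norm_num at this
    exact this
  have hβ3 : β ^ 3 / 6 ≤ β / 96 := by
    have : β ^ 3 ≤ β * (1 / 16) := by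
      rw [show β ^ 3 = β * β ^ 2 by ring]
      exact mul_le_mul_of_nonneg_left hβsq hβpos.le
    linarith
  have hs : 95 / 96 * β ≤ Real.sin β := by linarith
  have h1 : κ * (95 / 96 * β) ≤ 2 * κ * (Real.exp (-(1 / 2)) * Real.sin β) := by
    calc κ * (95 / 96 * β) ≤ κ * Real.sin β := mul_le_mul_of_nonneg_left hs hκ.le
      _ = 2 * κ * (1 / 2 * Real.sin β) := by ring
      _ ≤ 2 * κ * (Real.exp (-(1 / 2)) * Real.sin β) :=
          mul_le_mul_of_nonneg_left (mul_le_mul_of_nonneg_right he hsinpos) (by positivity)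
  have h2 : κ * (95 / 96 * β) ≤ δ + β ^ 2 := h1.trans hpp
  -- numbers: β = m/4, δ = m²/20, m ≤ κ, m > 0
  have hkm : m * m ≤ κ * m := mul_le_mul_of_nonneg_right hmκ hm0.le
  have h3 : 95 / 384 * (κ * m) ≤ 9 / 80 * (m * m) := by
    have e1 : κ * (95 / 96 * β) = 95 / 384 * (κ * m) := by rw [hβ]; ring
    have e2 : δ + β ^ 2 = 9 / 80 * (m * m) := by rw [hδ, hβ]; ring
    linarith [h2, e1, e2]
  have hY : 0 < m * m := mul_pos hm0 hm0
  linarith [hkm, h3, hY]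

end Summit.AtomisticToContinuum.HydrodynamicLimit.Theorems.CorrectorPressureDecayNegative.OrthMomentum

end
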